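import Summits.Ventures.GridStability.Bench.NE39SPSlabCMain
import Literature.MathematicalPhysics.PowerSystems.LuriePostnikovSlabPositivity
import HarnessLib

/-!
# «#53-LEVEL+ (POPOV)» — ★ #53's NE39SP slab certificate read through the POPOV-ONLY face bound: the
# SAME exact object certifies the level `18565/65536 ≈ 0.2833` instead of the rank-one rider's
# `c_max = 18818/163315625 ≈ 1.15·10⁻⁴` («#53″ LEVEL», ×2458) — NO matrix fact, 56 rational inequalities

Cell `gridfusion` (LADDER-GRIDFUSION G2.b SP lane, NE39SP tier); seat gridfusion-lit-6 (g8); an INSTANCE of lit-6's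
`Literature/MathematicalPhysics/PowerSystems/LuriePostnikovSlabPositivity.lean` §7
(`SlabCertificate.lt_V_of_mem_frontier_slab_of_popov`: on the face `|y_e| = γ_e` of the closed slab the Popov
integral of the TIGHT line alone bounds `V = xᵀPx + 2Σ λ_e∫₀^{y_e}F_e` from below by `λ_e a_e γ_e²`, since
`2∫₀^{y}F_e ≥ a_e y²` on the window and `P ⪰ 0`; Pai §4.6 (4.46) with the integral minorised). OBJECT: ★ #53's
certificate `NE39SPSlabC.cert` (Bench/NE39SPSlabCMain.lean; data Lyapunov/NE39SPSlabCData.lean: `λ_e = lamSQ e ∈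
[1.92, 44]`, `a_e = 5/8`, window `u = 1/4`, `γ_lo = 97/200`) — UNCHANGED. What changes is the LEVEL: every `c` with
`c ≤ λ_e·a·γ_lo²` on the 56 listed lines is admissible; the binding line is `e = 44` (`λ = 8276003519/2³²`),
`c = cPopQ = 18565/65536 ≈ 0.28328`. Ratios (kernel `level_ratios`): `cPopQ / c_max > 2458` («#53″ LEVEL»,
p527452, uniform rank-one `s = 261305/128`), `cPopQ / cEpsSQ > 84361` (the ε-level of ★ #53's main sentence).
COST: 56 closed rational inequalities decided in the kernel — no `LDLᵀ`, no Gram certificate, no clique glue.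

WHAT IS DECIDED / PROVED HERE: `cPopQ`; `popov_level_tests` (`0 ≤ γ_lo` form and `cPopQ ≤ λ_e·a·γ_lo²` ∀e, kernel);
`level_ratios`; `hsec53` (the per-line sector hypothesis of `cert` on the window `2·arctan(1/4)`, rebuilt from the
instance facts exactly as inside ★ #53's proof); `hfrPopov` (the face hypothesis at level `cPopQ`, by
`SlabCertificate.lt_V_of_mem_frontier_slab_of_popov`); `ne39_slab_roa_levelPopov` — ★ #53's sentence VERBATIM with
the level `cPopQ` (via model-2's `Params.tendsto_relState_of_slabCertificate`, whose `hfr` is an input, and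
`Params.tendsto_of_tendsto_relState`).

THREE COLUMNS. CERTIFIED (kernel): for MODEL M′_D = `(NE39SP.params D).phaseField` (★ #53's object: «MV-3 + lossless +
MV-P + D⟨declared: SYNTHETIC uniform D′ = 1/10⟩ + 60-Hz base (ω_s := 377) + V-frozen(LF) + |E|′(h12) + ref bus 39;
pipeline object with DECLARED SYNTHETIC DAMPING» — a structure-preserving NE39 VARIANT, not a sentence about the
printed New England system) and CLASS = slab `u = 1/4`, `γ_lo = 97/200`, level `cPopQ = 18565/65536` of the SAME `V`:
★ #53's region sentence with a 2458× larger level than «#53″ LEVEL»; inner estimate (sufficient, not sharp).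
VALIDATED: any simulated region; the reading «how large is {V ≤ cPopQ} in angle terms» is a datum, never a margin.
MODELLED: as ★ #53 verbatim. No sentence of this file says the New England system or any grid is stable.
[cite: Pai1981, §2.16 Theorem [18] eqs. (2.63)–(2.64) and §4.6 eqs. (4.45)–(4.46); Khalil2002, §7.1.2 Theorem 7.3; VuTuritsyn2017, §4.3 Theorem 1]
-/

noncomputable section

open Set Filter Topology Real Matrix
open Literature.MathematicalPhysics.PowerSystems
open Literature.MathematicalPhysics.PowerSystems.LyapunovFunctionFamily
open Literature.Computation.Certificates
open Summit.Ventures.GridStability.Models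
open Summit.Ventures.GridStability.Models.StructurePreserving
open Summit.Ventures.GridStability.Models.NE39SP
open Summit.Ventures.GridStability.Lyapunov.NE39SPSlabC (lamSQ aSQ epsSQ cEpsSQ)
open Summit.Ventures.GridStability.Bench.NE39SPSlabC (D hD cert)

namespace Summit.Ventures.GridStability.Bench.NE39SPSlabCPopov

/-! ### The one new literal and the kernel decisions -/

/-- The enlarged level `cPopQ = 18565/65536 ≈ 0.28328` (largest `2⁻¹⁶`-multiple with `c ≤ λ_e·a·γ_lo²` on all 56 lines). -/
def cPopQ : ℚ := 18565/65536

/-- **The Popov level tests** (kernel): `cPopQ ≤ λ_e · a · γ_lo²` on every listed line (`a = 5/8`, `γ_lo = 97/200`). -/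
theorem popov_level_tests : ∀ e : Fin 56, cPopQ ≤ lamSQ e * aSQ * (97 / 200 : ℚ) ^ 2 := by
  decide +kernel

/-- **The level ratios of record** (kernel): `cPopQ` exceeds 2458× the rank-one rider's `c_max = 18818/163315625`
and 84361× the ε-level `cEpsSQ` of ★ #53's main sentence. -/
theorem level_ratios : (2458 : ℚ) < cPopQ / (18818 / 163315625) ∧ (84361 : ℚ) < cPopQ / cEpsSQ := by
  constructor <;> norm_num [cPopQ, cEpsSQ]

/-! ### The sector hypothesis of ★ #53's certificate on the declared window (rebuilt, as inside ★ #53's proof) -/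

/-- **The per-line sector hypothesis `hsec` of `cert`** on `|ξ − σ*_e| ≤ 2·arctan(1/4)`: `a_e = 5/8 ≤ cos(θ + γ)`
(`θ = 2·arctan τ_LF`), `b_e = 1` (model-2's `relLurie_slab_sector_of_window`, as in `NE39SP.slab_roa_of_eps`). -/
theorem hsec53 : ∀ e ξ, |ξ - (NE39SP.relLurie D).δs e| ≤ (fun _ : Fin 56 => 2 * Real.arctan ((1 / 4 : ℚ) : ℝ)) e →
    cert.a e ≤ Real.cos ξ ∧ Real.cos ξ ≤ cert.b e := by
  have hτ1 : ((tauLF : ℚ) : ℝ) < 1 := by exact_mod_cast (show tauLF < 1 by norm_num [tauLF])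
  have hu0 : (0 : ℝ) < ((1 / 4 : ℚ) : ℝ) := by norm_num
  have hu1 : (((1 / 4 : ℚ)) : ℝ) ≤ 1 := by norm_num
  have hγpos : 0 ≤ 2 * Real.arctan (((1 / 4 : ℚ)) : ℝ) :=
    Lyapunov.StructurePreserving.two_mul_arctan_nonneg hu0.le
  have hθγ : 2 * Real.arctan ((tauLF : ℚ) : ℝ) + 2 * Real.arctan (((1 / 4 : ℚ)) : ℝ) ≤ π :=
    (two_arctan_add_lt_pi hτ1 hu1).le
  have ha : ∀ e, cert.a e ≤ ((slabSlope (1 / 4) : ℚ) : ℝ) := fun e => by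
    show ((aSQ : ℚ) : ℝ) ≤ ((slabSlope (1 / 4) : ℚ) : ℝ)
    exact_mod_cast (show aSQ ≤ slabSlope (1 / 4) by norm_num [aSQ, slabSlope, tauLF])
  have hb1 : ∀ e, (1 : ℝ) ≤ cert.b e := fun _ => le_refl _
  have ha' : ∀ e, cert.a e ≤ Real.cos (2 * Real.arctan ((tauLF : ℚ) : ℝ) + 2 * Real.arctan (((1 / 4 : ℚ)) : ℝ)) :=
    fun e => by
    rw [cos_two_arctan_add]
    have hsc : ((slabSlope (1 / 4) : ℚ) : ℝ) = ((1 - ((tauLF : ℚ) : ℝ) ^ 2) * (1 - (((1 / 4 : ℚ)) : ℝ) ^ 2)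
        - 4 * ((tauLF : ℚ) : ℝ) * ((1 / 4 : ℚ) : ℝ)) / ((1 + ((tauLF : ℚ) : ℝ) ^ 2) * (1 + (((1 / 4 : ℚ)) : ℝ) ^ 2)) := by
      push_cast [slabSlope]
      ring
    rw [← hsc]; exact ha e
  exact Params.relLurie_slab_sector_of_window (p := NE39SP.params D) (r := ref) (gnode := gnode) (src := srcV)
    (tgt := tgtV) (wt := wt) (δs := δ₀) cert hγpos hθγ lineAngle_abs_le_theta ha' hb1

/-! ### The face hypothesis at the Popov level and ★ #53's sentence at that level -/

/-- **`hfr` at level `cPopQ`, with NO matrix fact**: `cPopQ < V` on the frontier of the slab `|σ_e − σ*_e| < 2·arctan(1/4)`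
(lit-6's `SlabCertificate.lt_V_of_mem_frontier_slab_of_popov`; the strict `<` from `γ_lo < 2·arctan(1/4)`). -/
theorem hfrPopov : ∀ x ∈ frontier ((NE39SP.relLurie D).slab (fun _ : Fin 56 => 2 * Real.arctan ((1 / 4 : ℚ) : ℝ))),
    ((cPopQ : ℚ) : ℝ) < cert.V x := by
  intro x hx
  refine cert.lt_V_of_mem_frontier_slab_of_popov (γ := fun _ : Fin 56 => 2 * Real.arctan ((1 / 4 : ℚ) : ℝ))
    hsec53 (fun e => ?_) hx
  show ((cPopQ : ℚ) : ℝ) < cert.lam e * cert.a e * (2 * Real.arctan (((1 / 4 : ℚ)) : ℝ)) ^ 2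
  have hle : ((cPopQ : ℚ) : ℝ) ≤ ((lamSQ e : ℚ) : ℝ) * ((aSQ : ℚ) : ℝ) * (((97 / 200 : ℚ)) : ℝ) ^ 2 := by
    exact_mod_cast popov_level_tests e
  have hla : (0 : ℝ) < ((lamSQ e : ℚ) : ℝ) * ((aSQ : ℚ) : ℝ) := by
    have h1 : (0 : ℚ) < lamSQ e * aSQ := by
      have := popov_level_tests e
      have hc : (0 : ℚ) < cPopQ := by norm_num [cPopQ]
      nlinarith
    exact_mod_cast h1
  have hγ0 : (0 : ℝ) ≤ ((97 / 200 : ℚ) : ℝ) := by norm_num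
  -- `γ_lo = 97/200 < 2·arctan(1/4)` (model-2's `lt_two_arctan_of_sq_le`, as inside ★ #53's proof)
  have hglt : (((97 / 200 : ℚ)) : ℝ) < 2 * Real.arctan (((1 / 4 : ℚ)) : ℝ) :=
    lt_two_arctan_of_sq_le (by norm_num) hγ0 (by norm_num)
  have hsq : (((97 / 200 : ℚ)) : ℝ) ^ 2 < (2 * Real.arctan (((1 / 4 : ℚ)) : ℝ)) ^ 2 :=
    pow_lt_pow_left₀ hglt hγ0 two_ne_zero
  have hlt := mul_lt_mul_of_pos_left hsq hla
  have hlam : cert.lam e = ((lamSQ e : ℚ) : ℝ) := rfl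
  have ha : cert.a e = ((aSQ : ℚ) : ℝ) := rfl
  rw [hlam, ha]
  exact hle.trans_lt hlt

/-- **«#53-LEVEL+ (POPOV)» — ★ #53's certified region at the level `cPopQ = 18565/65536`.** For every phase point
`y = (δ, ω)` of MODEL M′_D = `(NE39SP.params D).phaseField` (`D′ = 1/10` DECLARED SYNTHETIC, as ★ #53) whose 56 listed
line-angle deviations satisfy `|σ_e − σ*_e| ≤ 97/200` and whose relative state has `V(relState y) ≤ cPopQ`
(`V = xᵀPx + 2Σ λ_e∫F_e` of ★ #53's `cert`, UNCHANGED): a solution from `y` exists and EVERY solution keeps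
`|σ_e(t) − σ*_e| < 2·atan(1/4)` and `V ≤ cPopQ` for all `t ≥ 0`, every bus-angle difference tends to the equilibrium's
and every machine frequency deviation tends to `0`. CERTIFIED for MODEL M′_D, CLASS slab `u = 1/4`, `γ_lo = 97/200`,
POPOV level (2458× «#53″ LEVEL»'s `c_max`); MODELLED / VALIDATED as ★ #53. Nothing here says the New England system is
stable. [cite: Pai1981, §2.16 Theorem [18] and §4.6 eqs. (4.45)–(4.46); Khalil2002, §7.1.2 Theorem 7.3; VuTuritsyn2017, §4.3 Theorem 1] -/
theorem ne39_slab_roa_levelPopov {y : (Fin 49 → ℝ) × (Fin 49 → ℝ)}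
    (hy : ∀ e, |(y.1 (srcV e) - y.1 (tgtV e)) - (δ₀ (srcV e) - δ₀ (tgtV e))| ≤ (97 : ℝ) / 200)
    (hyc : cert.V (relState ref gnode δ₀ y) ≤ ((cPopQ : ℚ) : ℝ)) :
    (∃ X : ℝ → (Fin 49 → ℝ) × (Fin 49 → ℝ), X 0 = y ∧
        ∀ T : ℝ, ∀ t ∈ Icc 0 T, HasDerivWithinAt X ((NE39SP.params D).phaseField (X t)) (Icc 0 T) t) ∧
      ∀ X : ℝ → (Fin 49 → ℝ) × (Fin 49 → ℝ), X 0 = y →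
        (∀ T : ℝ, ∀ t ∈ Icc 0 T, HasDerivWithinAt X ((NE39SP.params D).phaseField (X t)) (Icc 0 T) t) →
        (∀ t, 0 ≤ t →
            (∀ e, |((X t).1 (srcV e) - (X t).1 (tgtV e)) - (δ₀ (srcV e) - δ₀ (tgtV e))|
              < 2 * Real.arctan ((1 / 4 : ℚ) : ℝ)) ∧
            cert.V (relState ref gnode δ₀ (X t)) ≤ ((cPopQ : ℚ) : ℝ)) ∧
          (∀ v w, Tendsto (fun t => (X t).1 v - (X t).1 w) atTop (𝓝 (δ₀ v - δ₀ w))) ∧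
          ∀ v ∈ genS, Tendsto (fun t => (X t).2 v) atTop (𝓝 0) := by
  refine ⟨(NE39SP.params D).exists_phaseSolution_Icc y, fun X hX0 hX => ?_⟩
  subst hX0
  have hglo : (((97 / 200 : ℚ)) : ℝ) = (97 : ℝ) / 200 := by norm_num
  have hglt : (((97 / 200 : ℚ)) : ℝ) < 2 * Real.arctan (((1 / 4 : ℚ)) : ℝ) :=
    lt_two_arctan_of_sq_le (by norm_num) (by norm_num) (by norm_num)
  have h0' : ∀ e, |((X 0).1 (srcV e) - (X 0).1 (tgtV e)) - (δ₀ (srcV e) - δ₀ (tgtV e))|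
      < (fun _ : Fin 56 => 2 * Real.arctan ((1 / 4 : ℚ) : ℝ)) e := fun e => by
    have h := hy e
    rw [← hglo] at h
    exact h.trans_lt hglt
  obtain ⟨hstay, hlim⟩ := Params.tendsto_relState_of_slabCertificate (wellFormed hD) ref_not_mem
    gnode_injective mem_genS_iff (params_b_eq D) (pe_δ₀_eq_P0 D) cert hsec53 hfrPopov hX h0' hyc
  exact ⟨hstay, Params.tendsto_of_tendsto_relState (p := NE39SP.params D) mem_genS_iff hlim⟩

/-- The certified level as a decimal-friendly real: `cPopQ = 18565/65536`. -/
theorem cPopQ_eq : ((cPopQ : ℚ) : ℝ) = (18565 : ℝ) / 65536 := by norm_num [cPopQ]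

end Summit.Ventures.GridStability.Bench.NE39SPSlabCPopov

end
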